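import Summits.BirchSwinnertonDyer.BirchSwinnertonDyer.Theorems.KimAtThreeD7uRefinedModule
import HarnessLib

/-!
# D7-u, file C2″: the refined module on the FUNCTION-LEVEL ambient `C(U, X|U) × (G → X)`
# (route W2 = `KimAtThreeKolyvagin`, crux 19560 (C3) / TamDiv∞; seat `bsd-addord-w2-tamdiv`)

Second technical twin of file C2 (`KimAtThreeD7uRefinedModule`; the first, `…Ambient`, uses
`C(U, X)`).  Here the ambient is `P₁ = C(U, X|U) × (G → X)` with `X|U = subgroupRep X U`, so that the
first component has LITERALLY the type of the underlying function `z.1` of a crossed homomorphism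
`z ∈ Z¹(U, X)` (no unfolding of `TopRep.res` is needed when the lemmas of files A/B/C1 are invoked,
and the quotient `S ⧸ N` elaborates).  Contents (no definition, no new mathematics): `conj1_*`,
`exists_submodule_refined₁`, `exists_submodule_null₁`, `exists_act₁`, `act_combination₁`.

References: K. Rubin, *Euler Systems* (2000), §4.4; B. Mazur, K. Rubin, Mem. AMS 799 (2004), App. A.
-/

set_option autoImplicit false
-- the Theorems namespace of a single-conjunct summit repeats the summit name by design (D-0017)
set_option linter.dupNamespace false

noncomputable section

open CategoryTheory Function Finset
open Literature.NumberTheory.GaloisRepresentations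
open Literature.NumberTheory.EllipticCurves (subgroupConj subgroupConj_apply_coe)

universe u v

namespace Summit.BirchSwinnertonDyer.BirchSwinnertonDyer.Theorems.KimAtThreeD7uRefined

variable {R : Type v} [CommRing R] [TopologicalSpace R]
variable {G : Type u} [Group G] [TopologicalSpace G] [IsTopologicalGroup G]
variable (X T : TopRep.{u} R G) (U : Subgroup G) [U.Normal]

/-- Local notation: `𝔠⟦Y, g⟧ z` = the conjugate COCYCLE `x ↦ g • z(g⁻¹ x g)` on `U`. -/
local notation3 (prettyPrint := false) "𝔠⟦" Y ", " g "⟧" =>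
  contOneCocycles.pullback (subgroupConj U g) (conjRepHom Y U g)

/-- Local notation: `𝔠₁⟦g⟧ f` = the conjugate FUNCTION `x ↦ g • f(g⁻¹ x g)`, `f ∈ C(U, X|U)`
(literally the first component of file A's conjugate cocycle). -/
local notation3 (prettyPrint := false) "𝔠₁⟦" g "⟧" => fun (f : C(U, subgroupRep X U)) =>
  ((conjRepHom X U g).hom : C(TopRep.res (subgroupConj U g : U →* U) (subgroupRep X U), subgroupRep X U)).comp
    (f.comp (subgroupConj U g : C(U, U)))

/-- Local notation: `𝐫⟦red⟧ c` = the reduced cocycle `red ∘ c` on `U`. -/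
local notation3 (prettyPrint := false) "𝐫⟦" red "⟧" => contOneCocycles.pullback (ContinuousMonoidHom.id _)
    (X := subgroupRep T U) (Y := subgroupRep X U) ((TopRep.resFunctor (Subgroup.subtype U)).map red)

/-! ### §1 Conjugation on `C(U, X|U)` -/

/-- Values: `(𝔠₁⟦g⟧ f)(x) = g • f(g⁻¹ x g)`. [folklore] -/
theorem conj1_apply (g : G) (f : C(U, subgroupRep X U)) (x : U) :
    (𝔠₁⟦g⟧ f) x = X.ρ g (f ⟨g⁻¹ * x * g, (subgroupConj U g x).2⟩) := rfl

/-- On a crossed homomorphism the function-level conjugation is file A's action: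
`𝔠₁⟦g⟧ z = (g · z)` as functions (`rfl`). [folklore] -/
theorem conj1_coe (g : G) (z : contOneCocycles (subgroupRep X U)) : (𝔠₁⟦g⟧ z.1) = (𝔠⟦X, g⟧ z).1 :=
  rfl

/-- Conjugation preserves crossed homomorphisms. [folklore] -/
theorem conj1_mem (g : G) (f : C(U, subgroupRep X U)) (hf : f ∈ contOneCocycles (subgroupRep X U)) :
    (𝔠₁⟦g⟧ f) ∈ contOneCocycles (subgroupRep X U) := by
  have h := conj1_coe X U g ⟨f, hf⟩
  change (𝔠₁⟦g⟧ f) = _ at h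
  rw [h]
  exact (𝔠⟦X, g⟧ ⟨f, hf⟩).2

/-! ### §2 The submodules on the ambient `P₀ = C(U, subgroupRep X U) × (G → X)` -/

variable (B : Submodule R X) (D I : Subgroup G)
variable (hIU : ∀ (g τ : G), τ ∈ I → g * τ * g⁻¹ ∈ U)

omit [IsTopologicalGroup G] [U.Normal] in
/-- **The refined data form a submodule of `C(U, subgroupRep X U) × (G → X)`**: pairs `(f, η)` with `f` a
crossed homomorphism (C0) satisfying (C1), (C2) and both parts of (L) (file A); stated as an
existence. [folklore] -/
theorem exists_submodule_refined₁ :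
    ∃ S : Submodule R (C(U, subgroupRep X U) × (G → X)), ∀ q, q ∈ S ↔
      (q.1 ∈ contOneCocycles (subgroupRep X U) ∧
       (∀ (u : G) (hu : u ∈ U) (g : G), q.2 (u * g) - q.2 g - X.ρ g⁻¹ (q.1 ⟨u⁻¹, U.inv_mem hu⟩) ∈ B) ∧
       (∀ (g δ : G), δ ∈ D → q.2 (g * δ) - X.ρ δ⁻¹ (q.2 g) ∈ B) ∧
       (∀ (g δ : G), δ ∈ D → ∀ (h : g * δ * g⁻¹ ∈ U),
          X.ρ g⁻¹ (q.1 ⟨g * δ * g⁻¹, h⟩) - (X.ρ δ (q.2 g) - q.2 g) ∈ B) ∧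
       (∀ (g τ : G) (hτ : τ ∈ I),
          X.ρ g⁻¹ (q.1 ⟨g * τ * g⁻¹, hIU g τ hτ⟩) - (X.ρ τ (q.2 g) - q.2 g) = 0)) := by
  set C : Set (C(U, subgroupRep X U) × (G → X)) := {q |
      q.1 ∈ contOneCocycles (subgroupRep X U) ∧
       (∀ (u : G) (hu : u ∈ U) (g : G), q.2 (u * g) - q.2 g - X.ρ g⁻¹ (q.1 ⟨u⁻¹, U.inv_mem hu⟩) ∈ B) ∧
       (∀ (g δ : G), δ ∈ D → q.2 (g * δ) - X.ρ δ⁻¹ (q.2 g) ∈ B) ∧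
       (∀ (g δ : G), δ ∈ D → ∀ (h : g * δ * g⁻¹ ∈ U),
          X.ρ g⁻¹ (q.1 ⟨g * δ * g⁻¹, h⟩) - (X.ρ δ (q.2 g) - q.2 g) ∈ B) ∧
       (∀ (g τ : G) (hτ : τ ∈ I),
          X.ρ g⁻¹ (q.1 ⟨g * τ * g⁻¹, hIU g τ hτ⟩) - (X.ρ τ (q.2 g) - q.2 g) = 0)} with hC
  refine ⟨{ carrier := C, add_mem' := ?_, zero_mem' := ?_, smul_mem' := ?_ }, fun q => Iff.rfl⟩
  · rintro q q' ⟨h0, h1, h2, h3, h4⟩ ⟨h0', h1', h2', h3', h4'⟩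
    refine ⟨Submodule.add_mem _ h0 h0', fun u hu g => ?_, fun g δ hδ => ?_, fun g δ hδ h => ?_,
      fun g τ hτ => ?_⟩
    · have e : (q + q').2 (u * g) - (q + q').2 g - X.ρ g⁻¹ ((q + q').1 ⟨u⁻¹, U.inv_mem hu⟩) =
          (q.2 (u * g) - q.2 g - X.ρ g⁻¹ (q.1 ⟨u⁻¹, U.inv_mem hu⟩)) +
          (q'.2 (u * g) - q'.2 g - X.ρ g⁻¹ (q'.1 ⟨u⁻¹, U.inv_mem hu⟩)) := by
        simp only [Prod.snd_add, Prod.fst_add, Pi.add_apply, ContinuousMap.add_apply, map_add]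
        abel
      rw [e]; exact B.add_mem (h1 u hu g) (h1' u hu g)
    · have e : (q + q').2 (g * δ) - X.ρ δ⁻¹ ((q + q').2 g) =
          (q.2 (g * δ) - X.ρ δ⁻¹ (q.2 g)) + (q'.2 (g * δ) - X.ρ δ⁻¹ (q'.2 g)) := by
        simp only [Prod.snd_add, Pi.add_apply, map_add]
        abel
      rw [e]; exact B.add_mem (h2 g δ hδ) (h2' g δ hδ)
    · have e : X.ρ g⁻¹ ((q + q').1 ⟨g * δ * g⁻¹, h⟩) - (X.ρ δ ((q + q').2 g) - (q + q').2 g) =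
          (X.ρ g⁻¹ (q.1 ⟨g * δ * g⁻¹, h⟩) - (X.ρ δ (q.2 g) - q.2 g)) +
          (X.ρ g⁻¹ (q'.1 ⟨g * δ * g⁻¹, h⟩) - (X.ρ δ (q'.2 g) - q'.2 g)) := by
        simp only [Prod.snd_add, Prod.fst_add, Pi.add_apply, ContinuousMap.add_apply, map_add]
        abel
      rw [e]; exact B.add_mem (h3 g δ hδ h) (h3' g δ hδ h)
    · have e : X.ρ g⁻¹ ((q + q').1 ⟨g * τ * g⁻¹, hIU g τ hτ⟩) -
            (X.ρ τ ((q + q').2 g) - (q + q').2 g) =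
          (X.ρ g⁻¹ (q.1 ⟨g * τ * g⁻¹, hIU g τ hτ⟩) - (X.ρ τ (q.2 g) - q.2 g)) +
          (X.ρ g⁻¹ (q'.1 ⟨g * τ * g⁻¹, hIU g τ hτ⟩) - (X.ρ τ (q'.2 g) - q'.2 g)) := by
        simp only [Prod.snd_add, Prod.fst_add, Pi.add_apply, ContinuousMap.add_apply, map_add]
        abel
      rw [e, h4 g τ hτ, h4' g τ hτ, add_zero]
  · refine ⟨Submodule.zero_mem _, fun u hu g => ?_, fun g δ hδ => ?_, fun g δ hδ h => ?_,
      fun g τ hτ => ?_⟩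
    · simp only [Prod.snd_zero, Prod.fst_zero, Pi.zero_apply, ContinuousMap.zero_apply, map_zero,
        sub_self, Submodule.zero_mem]
    · simp only [Prod.snd_zero, Pi.zero_apply, map_zero, sub_self, Submodule.zero_mem]
    · simp only [Prod.snd_zero, Prod.fst_zero, Pi.zero_apply, ContinuousMap.zero_apply, map_zero,
        sub_self, Submodule.zero_mem]
    · simp only [Prod.snd_zero, Prod.fst_zero, Pi.zero_apply, ContinuousMap.zero_apply, map_zero,
        sub_self]
  · rintro a q ⟨h0, h1, h2, h3, h4⟩
    refine ⟨Submodule.smul_mem _ a h0, fun u hu g => ?_, fun g δ hδ => ?_, fun g δ hδ h => ?_,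
      fun g τ hτ => ?_⟩
    · have e : (a • q).2 (u * g) - (a • q).2 g - X.ρ g⁻¹ ((a • q).1 ⟨u⁻¹, U.inv_mem hu⟩) =
          a • (q.2 (u * g) - q.2 g - X.ρ g⁻¹ (q.1 ⟨u⁻¹, U.inv_mem hu⟩)) := by
        simp only [Prod.smul_snd, Prod.smul_fst, Pi.smul_apply, ContinuousMap.smul_apply, map_smul,
          smul_sub]
      rw [e]; exact B.smul_mem a (h1 u hu g)
    · have e : (a • q).2 (g * δ) - X.ρ δ⁻¹ ((a • q).2 g) = a • (q.2 (g * δ) - X.ρ δ⁻¹ (q.2 g)) := by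
        simp only [Prod.smul_snd, Pi.smul_apply, map_smul, smul_sub]
      rw [e]; exact B.smul_mem a (h2 g δ hδ)
    · have e : X.ρ g⁻¹ ((a • q).1 ⟨g * δ * g⁻¹, h⟩) - (X.ρ δ ((a • q).2 g) - (a • q).2 g) =
          a • (X.ρ g⁻¹ (q.1 ⟨g * δ * g⁻¹, h⟩) - (X.ρ δ (q.2 g) - q.2 g)) := by
        simp only [Prod.smul_snd, Prod.smul_fst, Pi.smul_apply, ContinuousMap.smul_apply, map_smul,
          smul_sub]
      rw [e]; exact B.smul_mem a (h3 g δ hδ h)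
    · have e : X.ρ g⁻¹ ((a • q).1 ⟨g * τ * g⁻¹, hIU g τ hτ⟩) -
            (X.ρ τ ((a • q).2 g) - (a • q).2 g) =
          a • (X.ρ g⁻¹ (q.1 ⟨g * τ * g⁻¹, hIU g τ hτ⟩) - (X.ρ τ (q.2 g) - q.2 g)) := by
        simp only [Prod.smul_snd, Prod.smul_fst, Pi.smul_apply, ContinuousMap.smul_apply, map_smul,
          smul_sub]
      rw [e, h4 g τ hτ, smul_zero]

omit [IsTopologicalGroup G] [U.Normal] in
/-- **The null data form a submodule of `C(U, subgroupRep X U) × (G → X)`**: pairs `(dα, η)` with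
`η_g ≡ g⁻¹ α (mod B)`. [folklore] -/
theorem exists_submodule_null₁ :
    ∃ N : Submodule R (C(U, subgroupRep X U) × (G → X)), ∀ q, q ∈ N ↔
      ∃ α : X, (∀ x : U, q.1 x = X.ρ (x : G) α - α) ∧ ∀ g, q.2 g - X.ρ g⁻¹ α ∈ B := by
  set C : Set (C(U, subgroupRep X U) × (G → X)) := {q |
      ∃ α : X, (∀ x : U, q.1 x = X.ρ (x : G) α - α) ∧ ∀ g, q.2 g - X.ρ g⁻¹ α ∈ B} with hC
  refine ⟨{ carrier := C, add_mem' := ?_, zero_mem' := ?_, smul_mem' := ?_ }, fun q => Iff.rfl⟩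
  · rintro q q' ⟨α, hα, hη⟩ ⟨α', hα', hη'⟩
    refine ⟨α + α', fun x => ?_, fun g => ?_⟩
    · rw [Prod.fst_add, ContinuousMap.add_apply, hα, hα', map_add]; abel
    · have e : (q + q').2 g - X.ρ g⁻¹ (α + α') = (q.2 g - X.ρ g⁻¹ α) + (q'.2 g - X.ρ g⁻¹ α') := by
        rw [Prod.snd_add, Pi.add_apply, map_add]; abel
      rw [e]; exact B.add_mem (hη g) (hη' g)
  · refine ⟨0, fun x => ?_, fun g => ?_⟩
    · simp only [Prod.fst_zero, ContinuousMap.zero_apply, map_zero, sub_self]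
    · simp only [Prod.snd_zero, Pi.zero_apply, map_zero, sub_self, Submodule.zero_mem]
  · rintro a q ⟨α, hα, hη⟩
    refine ⟨a • α, fun x => ?_, fun g => ?_⟩
    · rw [Prod.smul_fst, ContinuousMap.smul_apply, hα, map_smul, smul_sub]
    · have e : (a • q).2 g - X.ρ g⁻¹ (a • α) = a • (q.2 g - X.ρ g⁻¹ α) := by
        rw [Prod.smul_snd, Pi.smul_apply, map_smul, smul_sub]
      rw [e]; exact B.smul_mem a (hη g)

/-! ### §3 The linear action on `P₀` -/

/-- **The action `g · (f, η) = (g • f(g⁻¹ · g), η(g⁻¹ ·))` on `C(U, subgroupRep X U) × (G → X)` is `R`-linear,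
multiplicative and unital** (`∃` a family of linear maps). [folklore] -/
theorem exists_act₁ :
    ∃ act : G → (C(U, subgroupRep X U) × (G → X)) →ₗ[R] (C(U, subgroupRep X U) × (G → X)),
      (∀ g q, act g q = (𝔠₁⟦g⟧ q.1, fun h => q.2 (g⁻¹ * h))) ∧
      (∀ g g' q, act (g * g') q = act g (act g' q)) ∧ (∀ q, act 1 q = q) := by
  refine ⟨fun g =>
    { toFun := fun q => (𝔠₁⟦g⟧ q.1, fun h => q.2 (g⁻¹ * h))
      map_add' := fun q q' => ?_
      map_smul' := fun a q => ?_ }, fun g q => rfl, fun g g' q => ?_, fun q => ?_⟩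
  · ext1
    · ext x
      change X.ρ g ((q + q').1 _) = X.ρ g (q.1 _) + X.ρ g (q'.1 _)
      rw [Prod.fst_add, ContinuousMap.add_apply, map_add]
    · rfl
  · ext1
    · ext x
      change X.ρ g ((a • q).1 _) = a • X.ρ g (q.1 _)
      rw [Prod.smul_fst, ContinuousMap.smul_apply, map_smul]
    · rfl
  · change ((𝔠₁⟦g * g'⟧ q.1, fun h => q.2 ((g * g')⁻¹ * h)) : C(U, subgroupRep X U) × (G → X)) =
      (𝔠₁⟦g⟧ (𝔠₁⟦g'⟧ q.1), fun h => q.2 (g'⁻¹ * (g⁻¹ * h)))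
    ext1
    · ext x
      rw [conj1_apply, conj1_apply, conj1_apply, ← ρ_mul_apply]
      congr 2
      apply Subtype.ext
      change (g * g')⁻¹ * (x : G) * (g * g') = g'⁻¹ * (g⁻¹ * x * g) * g'
      simp only [mul_inv_rev, mul_assoc]
    · funext h
      change q.2 ((g * g')⁻¹ * h) = q.2 (g'⁻¹ * (g⁻¹ * h))
      rw [mul_inv_rev, mul_assoc]
  · change ((𝔠₁⟦(1 : G)⟧ q.1, fun h => q.2 ((1 : G)⁻¹ * h)) : C(U, subgroupRep X U) × (G → X)) = q
    ext1
    · ext x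
      rw [conj1_apply, map_one, one_apply_eq_self]
      exact congrArg _ (Subtype.ext (by change (1 : G)⁻¹ * x * 1 = x; group))
    · funext h
      change q.2 ((1 : G)⁻¹ * h) = q.2 h
      rw [inv_one, one_mul]

/-! ### §4 Linear combinations, read in `P₀` -/

variable (red : T ⟶ X)

/-- **`ρ̂` of a combination, inside `P₀`** (file C2's `act_combination`): for the linear action `act`
of `exists_act₁`, `Σ_j a_j • act(g_j) (red ∘ c, red ∘ s) =
(red ∘ (Σ_j a_j • g_j · c), red ∘ (Σ_j a_j • s(g_j⁻¹ ·)))`. [folklore] -/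
theorem act_combination₁
    (act : G → (C(U, subgroupRep X U) × (G → X)) →ₗ[R] (C(U, subgroupRep X U) × (G → X)))
    (hact : ∀ g q, act g q = (𝔠₁⟦g⟧ q.1, fun h => q.2 (g⁻¹ * h)))
    {κ : Type*} (J : Finset κ) (a : κ → R) (gj : κ → G)
    (c : contOneCocycles (subgroupRep T U)) (s : G → T) :
    ∑ j ∈ J, a j • act (gj j) ((𝐫⟦red⟧ c).1, fun h => red.hom (s h)) =
      ((𝐫⟦red⟧ (∑ j ∈ J, a j • 𝔠⟦T, gj j⟧ c)).1,
        fun h => red.hom ((∑ j ∈ J, a j • fun h' => s ((gj j)⁻¹ * h')) h)) := by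
  ext1
  · rw [Prod.fst_sum, red_combination X T U red J a gj c, Submodule.coe_sum]
    refine Finset.sum_congr rfl fun j _ => ?_
    rw [hact, Prod.smul_fst, Submodule.coe_smul, conj1_coe]
  · funext h
    change (∑ j ∈ J, a j • act (gj j) ((𝐫⟦red⟧ c).1, fun h => red.hom (s h))).2 h =
      red.hom ((∑ j ∈ J, a j • fun h' => s ((gj j)⁻¹ * h')) h)
    rw [Prod.snd_sum, Finset.sum_apply, eta_combination X T red J a gj s h]
    refine Finset.sum_congr rfl fun j _ => ?_
    rw [Prod.smul_snd, hact, Pi.smul_apply]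


/-! ### §5 Stability statements packaged for the main file (no group-element rewriting there) -/

/-- **The action preserves the refined data** (`S` of `exists_submodule_refined₁`; files A, C2″).
[folklore] -/
theorem act_mem_refined₁
    (act : G → (C(U, subgroupRep X U) × (G → X)) →ₗ[R] (C(U, subgroupRep X U) × (G → X)))
    (hact : ∀ g q, act g q = (𝔠₁⟦g⟧ q.1, fun h => q.2 (g⁻¹ * h)))
    (S : Submodule R (C(U, subgroupRep X U) × (G → X)))
    (hS : ∀ q, q ∈ S ↔
      (q.1 ∈ contOneCocycles (subgroupRep X U) ∧
       (∀ (u : G) (hu : u ∈ U) (g : G), q.2 (u * g) - q.2 g - X.ρ g⁻¹ (q.1 ⟨u⁻¹, U.inv_mem hu⟩) ∈ B) ∧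
       (∀ (g δ : G), δ ∈ D → q.2 (g * δ) - X.ρ δ⁻¹ (q.2 g) ∈ B) ∧
       (∀ (g δ : G), δ ∈ D → ∀ (h : g * δ * g⁻¹ ∈ U),
          X.ρ g⁻¹ (q.1 ⟨g * δ * g⁻¹, h⟩) - (X.ρ δ (q.2 g) - q.2 g) ∈ B) ∧
       (∀ (g τ : G) (hτ : τ ∈ I),
          X.ρ g⁻¹ (q.1 ⟨g * τ * g⁻¹, hIU g τ hτ⟩) - (X.ρ τ (q.2 g) - q.2 g) = 0)))
    (g : G) (q : C(U, subgroupRep X U) × (G → X)) (hq : q ∈ S) : act g q ∈ S := by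
  rw [hS] at hq ⊢
  obtain ⟨h0, h1, h2, h3, h4⟩ := hq
  rw [hact]
  exact ⟨conj1_mem X U g q.1 h0, C1_act X U B ⟨q.1, h0⟩ q.2 h1 g, C2_act X B D q.2 h2 g,
    L_mem_act X U B D ⟨q.1, h0⟩ q.2 h3 g, L_eq_act X U I hIU ⟨q.1, h0⟩ q.2 h4 g⟩

/-- **The action preserves the null data** (`N` of `exists_submodule_null₁`):
`g · (dα, η) = (d(gα), η(g⁻¹ ·))` with `η(g⁻¹h) ≡ h⁻¹ g α`. [folklore] -/
theorem act_mem_null₁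
    (act : G → (C(U, subgroupRep X U) × (G → X)) →ₗ[R] (C(U, subgroupRep X U) × (G → X)))
    (hact : ∀ g q, act g q = (𝔠₁⟦g⟧ q.1, fun h => q.2 (g⁻¹ * h)))
    (N : Submodule R (C(U, subgroupRep X U) × (G → X)))
    (hN : ∀ q, q ∈ N ↔ ∃ α : X, (∀ x : U, q.1 x = X.ρ (x : G) α - α) ∧ ∀ g, q.2 g - X.ρ g⁻¹ α ∈ B)
    (g : G) (q : C(U, subgroupRep X U) × (G → X)) (hq : q ∈ N) : act g q ∈ N := by
  rw [hN] at hq ⊢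
  obtain ⟨α, hα, hη⟩ := hq
  rw [hact]
  refine ⟨X.ρ g α, fun x => ?_, fun h => ?_⟩
  · change X.ρ g (q.1 ⟨g⁻¹ * x * g, (subgroupConj U g x).2⟩) = _
    rw [hα, Subgroup.coe_mk, map_sub, ← ρ_mul_apply, ← ρ_mul_apply,
      show g * (g⁻¹ * (x : G) * g) = x * g by group]
  · have h' := hη (g⁻¹ * h)
    change q.2 (g⁻¹ * h) - _ ∈ B
    rwa [mul_inv_rev, inv_inv, ρ_mul_apply] at h'

/-- **`U` moves refined data by null data**: for `u ∈ U` and `q ∈ S`, `u · q − q ∈ N` (file A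
`null_conj_sub_of_C1`). [folklore] -/
theorem act_sub_mem_null₁
    (act : G → (C(U, subgroupRep X U) × (G → X)) →ₗ[R] (C(U, subgroupRep X U) × (G → X)))
    (hact : ∀ g q, act g q = (𝔠₁⟦g⟧ q.1, fun h => q.2 (g⁻¹ * h)))
    (N : Submodule R (C(U, subgroupRep X U) × (G → X)))
    (hN : ∀ q, q ∈ N ↔ ∃ α : X, (∀ x : U, q.1 x = X.ρ (x : G) α - α) ∧ ∀ g, q.2 g - X.ρ g⁻¹ α ∈ B)
    (u : G) (hu : u ∈ U) (q : C(U, subgroupRep X U) × (G → X))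
    (h0 : q.1 ∈ contOneCocycles (subgroupRep X U))
    (h1 : ∀ (u : G) (hu : u ∈ U) (g : G), q.2 (u * g) - q.2 g - X.ρ g⁻¹ (q.1 ⟨u⁻¹, U.inv_mem hu⟩) ∈ B) :
    act u q - q ∈ N := by
  rw [hN, hact]
  obtain ⟨hz, hη⟩ := null_conj_sub_of_C1 X U B ⟨q.1, h0⟩ q.2 h1 u hu
  refine ⟨q.1 ⟨u, hu⟩, fun x => ?_, fun g => ?_⟩
  · have h := hz x
    rw [Submodule.coe_sub, ContinuousMap.sub_apply] at h
    rw [Prod.fst_sub, ContinuousMap.sub_apply]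
    exact h
  · exact hη g

omit [TopologicalSpace G] [IsTopologicalGroup G] in
/-- The group identity behind "the operators commute modulo `U ⊇ [G, G]`":
`ab = ba · (a⁻¹ b⁻¹ a b)`. [folklore] -/
theorem mul_eq_mul_mul_comm₁ (a b : G) : a * b = b * a * (a⁻¹ * b⁻¹ * a * b) := by
  group

end Summit.BirchSwinnertonDyer.BirchSwinnertonDyer.Theorems.KimAtThreeD7uRefined

end
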